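import Summits.AtomisticToContinuum.BoseEinsteinCondensation.Theorems.BECConjugateDominationHardCoreExtensionOpenPartition
import Summits.AtomisticToContinuum.BoseEinsteinCondensation.Theorems.BECConjugateDominationHardCoreExtensionPositiveOfWeightedLogGradientBound
import Literature.MathematicalPhysics.QuantumManyBody.PeriodicMaxFormBound
import HarnessLib

/-!
# Positivity on the free region from local triviality, transitivity and Bose symmetry — stub
# `stub_positiveOnFree_of_transitive` (L3) of line `third-law-current-floor`, crux
# `BECConjugateDomination.HardCoreExtension` (stmt-AtomisticToContinuum-11786)

Let `U ⊆ (ℝ/ℤ)^{N×3}` be any set on whose connected components the particle permutations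
`P_σ : t ↦ t ∘ (σ × id)` act transitively (for `t, t' ∈ U` some `P_σ t'` lies in the connected component
of `t` in `U`), and let `η ∈ L²` (Haar probability measure) be Bose-symmetric, `η ≠ 0`, `η = 0` a.e. off
`U`, with zero set `Z = {η = 0}` (canonical representative) locally trivial at every point of `U`. Then
`η ≠ 0` a.e. on `U` (`ae_ne_zero_on_of_transitive`; the registered stub `stub_positiveOnFree_of_transitive`
is the case of the free region `U = {t | ∀ i ≠ j, b < ρᵢⱼ(t)}`, `ρᵢⱼ = Torus.pairDist i j`).

Proof. The Haar measure charges open sets and the torus is second countable, so the open partition lemma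
(`locallyNull_or_locallyConull_of_isPreconnected`, then `measure_inter_eq_zero_of_locallyNull` /
`measure_diff_eq_zero_of_locallyConull`) gives `|C ∩ Z| = 0` or `|C \ Z| = 0` for the component `C` of a point
`t₀ ∈ U`. The relabellings `P_σ` preserve the Haar measure (`measurePreserving_compPerm`) and `Z` up to null sets
(`ae_eq_comp_perm_of_inner_symm`: Bose symmetry in momentum space is a.e. invariance), and by transitivity
`U ⊆ ⋃_σ P_σ⁻¹ C` (finite union), so `|U ∩ Z| = 0` or `|U \ Z| = 0`; the latter together with `η = 0`
a.e. off `U` forces `η = 0` in `L²`, a contradiction.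
References: M. Reed, B. Simon, *Methods of Modern Mathematical Physics IV* (1978), Thm XIII.44 (proof);
W. G. Faris, B. Simon, Duke Math. J. 42 (1975) 559–567.
-/

noncomputable section

namespace Summit.AtomisticToContinuum.BoseEinsteinCondensation.Cruxes.HardCoreExtension.ThirdLawCurrentFloorAlt

open MeasureTheory Filter UnitAddTorus Set Topology
open scoped ENNReal NNReal BigOperators Topology InnerProductSpace ComplexConjugate
open Literature.MathematicalPhysics.QuantumManyBody.BoseGas
open Literature.Analysis.FunctionSpaces

attribute [local instance] Literature.MathematicalPhysics.QuantumManyBody.BoseGas.formDomain_measureSpace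
  Literature.MathematicalPhysics.QuantumManyBody.BoseGas.formDomain_isProbabilityMeasure
  Literature.MathematicalPhysics.QuantumManyBody.BoseGas.formDomain_isProbabilityMeasure_pi

section PositiveOnFree

/-- **Covering by measure-preserving maps transports nullity**: if maps `P i` preserve `μ` (`μ (P i ⁻¹' A) = μ A`
for all sets `A`) and preserve `S` up to null sets, every point of `U` is mapped into `C` by some `P i`
(countably many `i`), and `μ (C ∩ S) = 0`, then `μ (U ∩ S) = 0`. [folklore] -/
theorem measure_inter_eq_zero_of_cover {X : Type*} [MeasurableSpace X] {μ : Measure X} {ι : Type*}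
    [Countable ι] (P : ι → X → X) (hmp : ∀ (i : ι) (A : Set X), μ (P i ⁻¹' A) = μ A) {S C U : Set X}
    (hS : ∀ i, ∀ᵐ t ∂μ, (P i t ∈ S ↔ t ∈ S)) (hcov : ∀ t ∈ U, ∃ i, P i t ∈ C)
    (hC : μ (C ∩ S) = 0) : μ (U ∩ S) = 0 := by
  have hsub : U ∩ S ⊆ ⋃ i, (P i ⁻¹' (C ∩ S) ∪ {t | ¬ (P i t ∈ S ↔ t ∈ S)}) := by
    rintro t ⟨htU, htS⟩
    obtain ⟨i, hi⟩ := hcov t htU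
    refine mem_iUnion.2 ⟨i, ?_⟩
    by_cases h : P i t ∈ S
    · exact Or.inl ⟨hi, h⟩
    · exact Or.inr fun h' => h (h'.2 htS)
  refine measure_mono_null hsub (measure_iUnion_null fun i => measure_union_null ?_ (ae_iff.1 (hS i)))
  rw [hmp]
  exact hC

variable {N : ℕ}

/-- The particle relabelling `t ↦ t ∘ (σ × id)` of the torus `(ℝ/ℤ)^{N×3}` is the coordinate permutation by
`σ × id` (pointwise form of `MeasurableEquiv.arrowCongr'`). [folklore] -/
theorem compPerm_prodCongr_apply (σ : Equiv.Perm (Fin N)) (t : UnitAddTorus (Fin N × Fin 3)) :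
    (MeasurableEquiv.arrowCongr' (Equiv.prodCongr σ (Equiv.refl (Fin 3))).symm (MeasurableEquiv.refl UnitAddCircle) t :
      UnitAddTorus (Fin N × Fin 3)) = fun p : Fin N × Fin 3 => t (σ p.1, p.2) := by
  rw [compPerm_apply]
  funext p
  rcases p with ⟨i, k⟩
  rfl

/-- The particle relabellings preserve the Haar probability measure of `(ℝ/ℤ)^{N×3}`:
`|P_σ⁻¹ A| = |A|` for every set `A`. [folklore] -/
theorem volume_preimage_relabel (σ : Equiv.Perm (Fin N)) (A : Set (UnitAddTorus (Fin N × Fin 3))) :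
    (volume : Measure (UnitAddTorus (Fin N × Fin 3))) ((fun t p => t (σ p.1, p.2)) ⁻¹' A) = volume A := by
  have h := (measurePreserving_compPerm (D := Fin N × Fin 3)
    (Equiv.prodCongr σ (Equiv.refl (Fin 3)))).measure_preimage_emb (MeasurableEquiv.measurableEmbedding _) A
  rw [← h]
  rfl

/-- **Bose symmetry is a.e. invariance under the particle relabellings**: for `η` in the Bose sector,
`η(t ∘ (σ × id)) = η(t)` for a.e. `t`. [folklore] -/
theorem ae_eq_relabel_of_mem_boseSymmetric {η : Lp ℂ 2 (volume : Measure (UnitAddTorus (Fin N × Fin 3)))}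
    (hη : η ∈ boseSymmetric N) (σ : Equiv.Perm (Fin N)) :
    ∀ᵐ t ∂(volume : Measure (UnitAddTorus (Fin N × Fin 3))),
      (η : UnitAddTorus (Fin N × Fin 3) → ℂ) (fun p : Fin N × Fin 3 => t (σ p.1, p.2)) =
        (η : UnitAddTorus (Fin N × Fin 3) → ℂ) t := by
  have h := ae_eq_comp_perm_of_inner_symm η (Equiv.prodCongr σ (Equiv.refl (Fin 3))) fun m => by
    rw [comp_prodCongr_eq σ m]; exact hη σ m
  filter_upwards [h] with t ht
  rwa [← compPerm_apply, compPerm_prodCongr_apply] at ht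

/-- **Positivity on a set with transitive relabelling action** (abstract form of L3). Let `U ⊆ (ℝ/ℤ)^{N×3}` be a
set such that for all `t, t' ∈ U` some relabelling `t' ∘ (σ × id)` lies in the connected component of `t` in `U`;
let `η ∈ L²` be Bose-symmetric, `η ≠ 0`, `η = 0` a.e. off `U`, with zero set locally trivial at every point of
`U`. Then `η ≠ 0` a.e. on `U`. [cite: ReedSimonIV1978, Thm XIII.44 (proof)] -/
theorem ae_ne_zero_on_of_transitive {U : Set (UnitAddTorus (Fin N × Fin 3))}
    (htrans : ∀ t ∈ U, ∀ t' ∈ U, ∃ σ : Equiv.Perm (Fin N),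
      (fun p : Fin N × Fin 3 => t' (σ p.1, p.2)) ∈ connectedComponentIn U t)
    (η : Lp ℂ 2 (volume : Measure (UnitAddTorus (Fin N × Fin 3)))) (hη : η ∈ boseSymmetric N) (hη0 : η ≠ 0)
    (hoff : ∀ᵐ t ∂(volume : Measure (UnitAddTorus (Fin N × Fin 3))),
      t ∉ U → (η : UnitAddTorus (Fin N × Fin 3) → ℂ) t = 0)
    (hloc : ∀ t₀ ∈ U, ∃ V ∈ 𝓝 t₀,
      (volume : Measure (UnitAddTorus (Fin N × Fin 3)))
          (V ∩ {t | (η : UnitAddTorus (Fin N × Fin 3) → ℂ) t = 0}) = 0 ∨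
        (volume : Measure (UnitAddTorus (Fin N × Fin 3)))
          (V \ {t | (η : UnitAddTorus (Fin N × Fin 3) → ℂ) t = 0}) = 0) :
    ∀ᵐ t ∂(volume : Measure (UnitAddTorus (Fin N × Fin 3))),
      t ∈ U → (η : UnitAddTorus (Fin N × Fin 3) → ℂ) t ≠ 0 := by
  haveI : (volume : Measure UnitAddCircle).IsOpenPosMeasure :=
    inferInstanceAs ((AddCircle.haarAddCircle : Measure UnitAddCircle).IsOpenPosMeasure)
  haveI : (volume : Measure (UnitAddTorus (Fin N × Fin 3))).IsOpenPosMeasure := Measure.pi.isOpenPosMeasure _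
  set Z : Set (UnitAddTorus (Fin N × Fin 3)) := {t | (η : UnitAddTorus (Fin N × Fin 3) → ℂ) t = 0} with hZ
  -- the relabellings, measure preserving and preserving `Z`, `Zᶜ` up to null sets
  set P : Equiv.Perm (Fin N) → UnitAddTorus (Fin N × Fin 3) → UnitAddTorus (Fin N × Fin 3) :=
    fun σ t p => t (σ p.1, p.2) with hP
  have hmp : ∀ (σ : Equiv.Perm (Fin N)) (A : Set (UnitAddTorus (Fin N × Fin 3))),
      volume (P σ ⁻¹' A) = volume A := fun σ A => volume_preimage_relabel σ A
  have hZinv : ∀ σ : Equiv.Perm (Fin N), ∀ᵐ t ∂(volume : Measure (UnitAddTorus (Fin N × Fin 3))),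
      (P σ t ∈ Z ↔ t ∈ Z) := fun σ => by
    filter_upwards [ae_eq_relabel_of_mem_boseSymmetric hη σ] with t ht
    simp only [hZ, hP, mem_setOf_eq, ht]
  have hZcinv : ∀ σ : Equiv.Perm (Fin N), ∀ᵐ t ∂(volume : Measure (UnitAddTorus (Fin N × Fin 3))),
      (P σ t ∈ Zᶜ ↔ t ∈ Zᶜ) := fun σ => by
    filter_upwards [hZinv σ] with t ht
    rw [mem_compl_iff, mem_compl_iff, ht]
  -- reduce the goal to `|U ∩ Z| = 0`
  rw [ae_iff]
  have hgoal : {t | ¬ (t ∈ U → (η : UnitAddTorus (Fin N × Fin 3) → ℂ) t ≠ 0)} = U ∩ Z := by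
    ext t
    simp only [hZ, mem_setOf_eq, mem_inter_iff, ne_eq, Classical.not_imp, not_not]
  rw [hgoal]
  rcases U.eq_empty_or_nonempty with hU | ⟨t₀, ht₀⟩
  · rw [hU, empty_inter, measure_empty]
  -- the open partition lemma on the component of `t₀`
  have hloc' : ∀ x ∈ U, (∃ V ∈ 𝓝 x, (volume : Measure (UnitAddTorus (Fin N × Fin 3))) (V ∩ Z) = 0) ∨
      (∃ V ∈ 𝓝 x, (volume : Measure (UnitAddTorus (Fin N × Fin 3))) (V \ Z) = 0) := fun x hx => by
    obtain ⟨V, hV, h | h⟩ := hloc x hx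
    exacts [Or.inl ⟨V, hV, h⟩, Or.inr ⟨V, hV, h⟩]
  have hcov : ∀ t ∈ U, ∃ σ : Equiv.Perm (Fin N), P σ t ∈ connectedComponentIn U t₀ :=
    fun t ht => htrans t₀ ht₀ t ht
  rcases locallyNull_or_locallyConull_of_isPreconnected volume hloc' isPreconnected_connectedComponentIn
      (connectedComponentIn_subset U t₀) with h | h
  · exact measure_inter_eq_zero_of_cover P hmp hZinv hcov (measure_inter_eq_zero_of_locallyNull volume h)
  · exfalso
    have hCZ : (volume : Measure (UnitAddTorus (Fin N × Fin 3))) (connectedComponentIn U t₀ ∩ Zᶜ) = 0 := by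
      rw [← sdiff_eq]; exact measure_diff_eq_zero_of_locallyConull volume h
    have hUZ : (volume : Measure (UnitAddTorus (Fin N × Fin 3))) (U ∩ Zᶜ) = 0 :=
      measure_inter_eq_zero_of_cover P hmp hZcinv hcov hCZ
    have hon : ∀ᵐ t ∂(volume : Measure (UnitAddTorus (Fin N × Fin 3))),
        t ∈ U → (η : UnitAddTorus (Fin N × Fin 3) → ℂ) t = 0 := by
      rw [ae_iff]
      have hset : {t | ¬ (t ∈ U → (η : UnitAddTorus (Fin N × Fin 3) → ℂ) t = 0)} = U ∩ Zᶜ := by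
        ext t
        simp only [hZ, mem_setOf_eq, mem_inter_iff, mem_compl_iff, Classical.not_imp]
      rw [hset]
      exact hUZ
    refine hη0 (Lp.eq_zero_iff_ae_eq_zero.2 ?_)
    filter_upwards [hoff, hon] with t h1 h2
    by_cases ht : t ∈ U
    · exact h2 ht
    · exact h1 ht

/-- **L3 `stub_positiveOnFree_of_transitive`** (positivity on the free region from local triviality,
transitivity and Bose symmetry). Let `b ∈ ℝ`, `U = {t | ∀ i ≠ j, b < ρᵢⱼ(t)}` (`ρᵢⱼ = Torus.pairDist i j`),
and suppose the particle permutations act transitively on the connected components of `U`. Let `η ∈ L²`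
be Bose-symmetric (`boseSymmetric N`), `η ≠ 0`, `η = 0` a.e. off `U`, with zero set `Z = {η = 0}` locally
trivial at every point of `U`. Then `η ≠ 0` a.e. on `U` (the case `U` = free region of
`ae_ne_zero_on_of_transitive`). [cite: ReedSimonIV1978, Thm XIII.44 (proof)] -/
theorem stub_positiveOnFree_of_transitive :
    ∀ (N : ℕ) (b : ℝ),
      (∀ t ∈ {t : UnitAddTorus (Fin N × Fin 3) | ∀ i j : Fin N, i ≠ j → b < Torus.pairDist i j t},
        ∀ t' ∈ {t : UnitAddTorus (Fin N × Fin 3) | ∀ i j : Fin N, i ≠ j → b < Torus.pairDist i j t},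
          ∃ σ : Equiv.Perm (Fin N), (fun p : Fin N × Fin 3 => t' (σ p.1, p.2)) ∈
            connectedComponentIn {t : UnitAddTorus (Fin N × Fin 3) | ∀ i j : Fin N, i ≠ j → b < Torus.pairDist i j t} t) →
      ∀ η : Lp ℂ 2 (volume : Measure (UnitAddTorus (Fin N × Fin 3))), η ∈ boseSymmetric N → η ≠ 0 →
        (∀ᵐ t ∂(volume : Measure (UnitAddTorus (Fin N × Fin 3))),
          t ∉ {t : UnitAddTorus (Fin N × Fin 3) | ∀ i j : Fin N, i ≠ j → b < Torus.pairDist i j t} →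
            (η : UnitAddTorus (Fin N × Fin 3) → ℂ) t = 0) →
        (∀ t₀ ∈ {t : UnitAddTorus (Fin N × Fin 3) | ∀ i j : Fin N, i ≠ j → b < Torus.pairDist i j t},
          ∃ U ∈ 𝓝 t₀,
            (volume : Measure (UnitAddTorus (Fin N × Fin 3)))
                (U ∩ {t | (η : UnitAddTorus (Fin N × Fin 3) → ℂ) t = 0}) = 0 ∨
              (volume : Measure (UnitAddTorus (Fin N × Fin 3)))
                (U \ {t | (η : UnitAddTorus (Fin N × Fin 3) → ℂ) t = 0}) = 0) →
        ∀ᵐ t ∂(volume : Measure (UnitAddTorus (Fin N × Fin 3))),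
          t ∈ {t : UnitAddTorus (Fin N × Fin 3) | ∀ i j : Fin N, i ≠ j → b < Torus.pairDist i j t} →
            (η : UnitAddTorus (Fin N × Fin 3) → ℂ) t ≠ 0 := by
  intro N _b htrans η hη hη0 hoff hloc
  exact ae_ne_zero_on_of_transitive htrans η hη hη0 hoff hloc

end PositiveOnFree

end Summit.AtomisticToContinuum.BoseEinsteinCondensation.Cruxes.HardCoreExtension.ThirdLawCurrentFloorAlt

end
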